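import Mathlib
import Summits.Ventures.PercRepro2.Defs
import Summits.Ventures.PercRepro2.Graph
import Summits.Ventures.PercRepro2.Harris
import Summits.Ventures.PercRepro2.Events
import Summits.Ventures.PercRepro2.Independence
import Summits.Ventures.PercRepro2.Induced
import Summits.Ventures.PercRepro2.HullTree
import Summits.Ventures.PercRepro2.SideCluster
import Summits.Ventures.PercRepro2.GateDefs
import Summits.Ventures.PercRepro2.GateAnatomy
import Summits.Ventures.PercRepro2.GateCylinder
import Summits.Ventures.PercRepro2.GateForest
import Summits.Ventures.PercRepro2.GateSplit
import Summits.Ventures.PercRepro2.GateSplitForest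
import Summits.Ventures.PercRepro2.ForestCluster
import Summits.Ventures.PercRepro2.GateLSM
import Summits.Ventures.PercRepro2.GateForestPaths
import Summits.Ventures.PercRepro2.GateFeedbackForest
import Summits.Ventures.PercRepro2.GateFeedback

/-!
# The feedback-vertex gate for every entry set `A`: `(GATE A,{w})` when `G − t` is a forest
(blind cell PercRepro2, mine-c g9; proofs/MINEC-FEEDBACK.md Theorem 1, general form)

`GateSplit.massA₂ A {w} W = P(C(s) = W ∧ W avoids {t} ∪ A ∧ w ∈ C(t))` factorises exactly as the
class-B mass of `GateFeedback` with the extra down-set indicator `W ∩ A = ∅`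
(`massA₂_eq`); the three-factor argument gives `GateSplit.MassA₂LogSupermod`, hence
`Gate.GateRow s {t} a b A {w}` by `GateSplitForest.gateRow_of_massA₂_logSupermod`.
-/

namespace Summit.Ventures.PercRepro2

namespace GateFeedback

open scoped Classical

variable {V : Type*} {E : Type*} [Fintype E] [Fintype V]
variable {R : Type*} [Field R] [LinearOrder R] [IsStrictOrderedRing R]

omit [LinearOrder R] [IsStrictOrderedRing R] in
/-- **The class-A₂ mass factorises** (single exit vertex `w`, any entry set `A`): when `G − t` is a
forest, `massA₂ W = P(C(s) = W) · P(hitT W)` if `t, w ∉ W` and `W ∩ A = ∅`, and `0` otherwise. -/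
theorem massA₂_eq (p : E → R) {ends : E → Sym2 V} {s t w : V} (A : Finset V)
    (hF : Hull.IsForest (endsF ends t)) (hw : w ≠ t) (W : Finset V) :
    GateSplit.massA₂ p ends s t A {w} W =
      if t ∈ W ∨ w ∈ W ∨ ∃ x ∈ A, x ∈ W then 0 else
        prob p (clusterEvent ends s (↑W : Set V)) * prob p (hitT ends t w W) := by
  unfold GateSplit.massA₂
  rw [show GateSplit.classA₂ ends s t A {w} =
      clusterInEvent ends t {W : Set V | w ∈ W} ∩ avoidAll ends s ({t} ∪ A) from by
    unfold GateSplit.classA₂; rw [GateSplitForest.hitsUW_singleton]]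
  split_ifs with h
  · rw [show clusterEvent ends s (↑W : Set V) ∩
        (clusterInEvent ends t {W : Set V | w ∈ W} ∩ avoidAll ends s ({t} ∪ A)) = ∅ from ?_,
      prob_empty]
    ext ω
    simp only [Set.mem_inter_iff, mem_clusterInEvent, Set.mem_setOf_eq, avoidAll,
      Set.mem_empty_iff_false, iff_false, not_and, mem_clusterEvent]
    intro hW hcw hav
    have hmem : ∀ v ∈ W, Conn ends ω s v := fun v hv => by
      have : v ∈ cluster ends ω s := by rw [hW]; exact Finset.mem_coe.2 hv
      exact this
    rcases h with h | h | ⟨x, hxA, hxW⟩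
    · exact hav t (by simp) (hmem t h)
    · exact hav t (by simp) ((hmem w h).trans (conn_symm hcw))
    · exact hav x (Finset.mem_union_right _ hxA) (hmem x hxW)
  · simp only [not_or, not_exists, not_and] at h
    obtain ⟨ht, hwW, hA⟩ := h
    have hset : clusterEvent ends s (↑W : Set V) ∩
        (clusterInEvent ends t {W : Set V | w ∈ W} ∩ avoidAll ends s ({t} ∪ A)) =
        clusterEvent ends s (↑W : Set V) ∩ {ω | Conn ends ω t w} := by
      ext ω
      simp only [Set.mem_inter_iff, mem_clusterInEvent, Set.mem_setOf_eq, avoidAll,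
        mem_clusterEvent]
      constructor
      · rintro ⟨hW, hcw, _⟩; exact ⟨hW, hcw⟩
      · rintro ⟨hW, hcw⟩
        refine ⟨hW, hcw, fun v hv hc => ?_⟩
        have : v ∈ cluster ends ω s := hc
        rw [hW] at this
        rcases Finset.mem_union.1 hv with hv | hv
        · rw [Finset.mem_singleton] at hv
          subst hv
          exact ht (Finset.mem_coe.1 this)
        · exact hA v hv (Finset.mem_coe.1 this)
    rw [hset, clusterEvent_inter_conn_eq hF hw hwW]
    exact prob_inter_eq_mul_of_dependsOn p disjoint_compl_right (dependsOn_clusterEvent ends s _)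
      (dependsOn_hitT ht)

/-- **THEOREM (feedback-vertex gate, every entry set, FKG form).** If `G − t` is a forest, the
class-A₂ mass of the gadget `(A, {w})` is log-supermodular on `Finset V`. -/
theorem massA₂LogSupermod_of_isForest_del {p : E → R} (hp : IsProbVec p) {ends : E → Sym2 V}
    {s t w : V} (A : Finset V) (hF : Hull.IsForest (endsF ends t)) (hw : w ≠ t) :
    GateSplit.MassA₂LogSupermod p ends s t A {w} := by
  intro W₁ W₂
  have hnn : ∀ W, 0 ≤ GateSplit.massA₂ p ends s t A {w} W := fun W => prob_nonneg hp _
  by_cases h₁ : t ∈ W₁ ∨ w ∈ W₁ ∨ ∃ x ∈ A, x ∈ W₁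
  · rw [massA₂_eq p A hF hw W₁, if_pos h₁, zero_mul]; exact mul_nonneg (hnn _) (hnn _)
  by_cases h₂ : t ∈ W₂ ∨ w ∈ W₂ ∨ ∃ x ∈ A, x ∈ W₂
  · rw [massA₂_eq p A hF hw W₂, if_pos h₂, mul_zero]; exact mul_nonneg (hnn _) (hnn _)
  simp only [not_or, not_exists, not_and] at h₁ h₂
  obtain ⟨ht₁, hw₁, hA₁⟩ := h₁
  obtain ⟨ht₂, hw₂, hA₂⟩ := h₂
  have hI : ¬ (t ∈ W₁ ∩ W₂ ∨ w ∈ W₁ ∩ W₂ ∨ ∃ x ∈ A, x ∈ W₁ ∩ W₂) := by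
    rintro (h | h | ⟨x, hx, h⟩)
    · exact ht₁ (Finset.mem_inter.1 h).1
    · exact hw₁ (Finset.mem_inter.1 h).1
    · exact hA₁ x hx (Finset.mem_inter.1 h).1
  have hU : ¬ (t ∈ W₁ ∪ W₂ ∨ w ∈ W₁ ∪ W₂ ∨ ∃ x ∈ A, x ∈ W₁ ∪ W₂) := by
    rintro (h | h | ⟨x, hx, h⟩)
    · rcases Finset.mem_union.1 h with h | h
      · exact ht₁ h
      · exact ht₂ h
    · rcases Finset.mem_union.1 h with h | h
      · exact hw₁ h
      · exact hw₂ h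
    · rcases Finset.mem_union.1 h with h | h
      · exact hA₁ x hx h
      · exact hA₂ x hx h
  have htI : t ∉ W₁ ∩ W₂ := fun h => ht₁ (Finset.mem_inter.1 h).1
  have htU : t ∉ W₁ ∪ W₂ := fun h => hU (Or.inl h)
  rw [massA₂_eq p A hF hw W₁, massA₂_eq p A hF hw W₂, massA₂_eq p A hF hw (W₁ ∩ W₂),
    massA₂_eq p A hF hw (W₁ ∪ W₂),
    if_neg (by simp only [not_or, not_exists, not_and]; exact ⟨ht₁, hw₁, hA₁⟩),
    if_neg (by simp only [not_or, not_exists, not_and]; exact ⟨ht₂, hw₂, hA₂⟩), if_neg hI, if_neg hU,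
    prob_clusterEvent_eq p ends s t ht₁, prob_clusterEvent_eq p ends s t ht₂,
    prob_clusterEvent_eq p ends s t htI, prob_clusterEvent_eq p ends s t htU]
  have hpF := IsProbVec.pF hp ends t
  have hνF : ∀ W, 0 ≤ prob (pF p ends t) (clusterEvent (endsF ends t) s (↑W : Set V)) :=
    fun W => prob_nonneg hpF _
  have hκ0 : ∀ W, 0 ≤ prob p (hitT ends t w W) := fun W => prob_nonneg hp _
  have hA : prob (pF p ends t) (clusterEvent (endsF ends t) s (↑W₁ : Set V)) *
      prob (pF p ends t) (clusterEvent (endsF ends t) s (↑W₂ : Set V)) ≤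
      prob (pF p ends t) (clusterEvent (endsF ends t) s (↑(W₁ ∩ W₂) : Set V)) *
      prob (pF p ends t) (clusterEvent (endsF ends t) s (↑(W₁ ∪ W₂) : Set V)) := by
    have h := ForestCluster.clusterLogSupermod_of_isForest (pF p ends t) hpF hF s W₁ W₂
    unfold clusterMass at h
    simp only [prob_congr_inst (fun a b => Classical.propDecidable (a = b))
      (inferInstance : DecidableEq {e // e ∈ Ft ends t})] at h
    exact h
  have hB := tau_mul p ends t W₁ W₂
  by_cases hz₁ : prob (pF p ends t) (clusterEvent (endsF ends t) s (↑W₁ : Set V)) = 0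
  · rw [hz₁]
    simp only [zero_mul]
    exact mul_nonneg (mul_nonneg (mul_nonneg (hνF _) (tau_nonneg hp ends t _)) (hκ0 _))
      (mul_nonneg (mul_nonneg (hνF _) (tau_nonneg hp ends t _)) (hκ0 _))
  by_cases hz₂ : prob (pF p ends t) (clusterEvent (endsF ends t) s (↑W₂ : Set V)) = 0
  · rw [hz₂]
    simp only [zero_mul, mul_zero]
    exact mul_nonneg (mul_nonneg (mul_nonneg (hνF _) (tau_nonneg hp ends t _)) (hκ0 _))
      (mul_nonneg (mul_nonneg (hνF _) (tau_nonneg hp ends t _)) (hκ0 _))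
  obtain ⟨ω₁, hω₁⟩ := nonempty_of_prob_ne_zero hz₁
  obtain ⟨ω₂, hω₂⟩ := nonempty_of_prob_ne_zero hz₂
  have hr₁ := ForestCluster.isRootedSub_of_clusterEvent hω₁
  have hr₂ := ForestCluster.isRootedSub_of_clusterEvent hω₂
  have hC : prob p (hitT ends t w W₁) * prob p (hitT ends t w W₂) ≤
      prob p (hitT ends t w (W₁ ∩ W₂)) * prob p (hitT ends t w (W₁ ∪ W₂)) := by
    rcases GateForestPaths.avoidB_nested (ends := endsF ends t) (t := w) (B := nbrs ends t) hF hr₁ hr₂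
      with hle | hle
    · have e1 : hitT ends t w W₁ ⊆ hitT ends t w (W₁ ∪ W₂) :=
        hitT_mono (by rw [GateForestPaths.avoidB_union]; exact Finset.subset_inter le_rfl hle)
      have e2 : hitT ends t w W₂ ⊆ hitT ends t w (W₁ ∩ W₂) :=
        hitT_mono (Finset.subset_union_right.trans
          (GateForestPaths.avoidB_inter_supset (endsF ends t) w (nbrs ends t) W₁ W₂))
      calc prob p (hitT ends t w W₁) * prob p (hitT ends t w W₂)
          ≤ prob p (hitT ends t w (W₁ ∪ W₂)) * prob p (hitT ends t w (W₁ ∩ W₂)) :=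
            mul_le_mul (prob_mono hp e1) (prob_mono hp e2) (hκ0 _) (hκ0 _)
        _ = _ := mul_comm _ _
    · have e1 : hitT ends t w W₂ ⊆ hitT ends t w (W₁ ∪ W₂) :=
        hitT_mono (by rw [GateForestPaths.avoidB_union]; exact Finset.subset_inter hle le_rfl)
      have e2 : hitT ends t w W₁ ⊆ hitT ends t w (W₁ ∩ W₂) :=
        hitT_mono (Finset.subset_union_left.trans
          (GateForestPaths.avoidB_inter_supset (endsF ends t) w (nbrs ends t) W₁ W₂))
      exact mul_le_mul (prob_mono hp e2) (prob_mono hp e1) (hκ0 _) (hκ0 _)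
  exact three_factor hA hB hC
    (mul_nonneg (tau_nonneg hp ends t _) (tau_nonneg hp ends t _)) (mul_nonneg (hκ0 _) (hκ0 _))
    (mul_nonneg (mul_nonneg (hνF _) (hνF _))
      (mul_nonneg (tau_nonneg hp ends t _) (tau_nonneg hp ends t _)))

/-- **THEOREM (the feedback-vertex gate, every entry set).** If every cycle of `G` passes through
the avoided vertex `t`, then `(GATE A,{w})` holds for every entry set `A` and exit vertex `w ≠ t`:
`Gate.GateRow s {t} a b A {w}`. -/
theorem gateRow_general_of_isForest_del {p : E → R} (hp : IsProbVec p) {ends : E → Sym2 V}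
    (s t a b w : V) (A : Finset V) (hF : Hull.IsForest (endsF ends t)) (hw : w ≠ t) :
    Gate.GateRow p ends s {t} a b A {w} :=
  GateSplitForest.gateRow_of_massA₂_logSupermod p ends s t a b A {w} hp
    (massA₂LogSupermod_of_isForest_del hp A hF hw)

end GateFeedback

end Summit.Ventures.PercRepro2
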